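import Literature.MathematicalPhysics.KineticTheory.HardSphereDecoratedPairSumVariance
import Literature.Probability.Moments.DecorrelationExtensionWindow
import HarnessLib

/-!
# Variance of decorated pair sums under the canonical hard-sphere measure, WINDOWED plateau

Topic `Literature/MathematicalPhysics/KineticTheory` (kind proof; windowed twin of `HardSphereDecoratedPairSumVariance.lean`).
The decorated pair-pair decorrelation hypothesis `hdec` (four distinct labels) is assumed ONLY for displacement sets `T, T'`
inside the support window `D` of the decoration `φ` (the form a cluster expansion delivers: the windowed plateau `PlateauWindow`
of the rung-0 closures of `JParityClosure.EvenStressEnskog` / `RateFloor`, whose `D` is the near-contact shell); the conclusions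
are unchanged and the proofs verbatim, through `Literature.Probability.Moments.abs_covariance_le_of_indicator_of_abs_le_window`:

* `abs_covariance_decorated_le_of_dec_window`, `abs_covariance_decorated_le_window`, `variance_decoratedPairSum_le_window`.

References: D. Ruelle (1969) §4.2 [Ruelle1969]; P. Doukhan (1994) §1.2.2. [folklore]
-/

noncomputable section

namespace Literature.MathematicalPhysics.KineticTheory

open MeasureTheory ProbabilityTheory Set
open scoped ENNReal
open Literature.Probability.Moments

variable {σ : ℝ} {N : ℕ}

/-- **Case C (disjoint pairs), windowed**: as `abs_covariance_decorated_le_of_dec`, with `hdec` only for `T, T' ⊆ D`. [folklore] -/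
theorem abs_covariance_decorated_le_of_dec_window (hsd : SmallDensity uniformProfile σ) {h φ : T3 → ℝ}
    (hh : Measurable h) (hh1 : ∀ y, |h y| ≤ 1) (hφ : Measurable φ) {B : ℝ} (hB : 0 < B)
    (hφB : ∀ d, |φ d| ≤ B) {D : Set T3} (hφD : ∀ d, φ d ≠ 0 → d ∈ D) {ζ : ℝ} (hζ : 0 ≤ ζ)
    {i j k l : Fin (N + 1)}
    (hdec : ∀ T T' : Set T3, MeasurableSet T → MeasurableSet T' → T ⊆ D → T' ⊆ D →
      |(∫ x, h (x i) * T.indicator (fun _ => (1 : ℝ)) (x j - x i) * (h (x k) * T'.indicator (fun _ => (1 : ℝ)) (x l - x k))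
          ∂posGibbsMeasure (fun _ : T3 => (1 : ℝ)) (hsDiameter σ N) (N + 1)) -
        (∫ x, h (x i) * T.indicator (fun _ => (1 : ℝ)) (x j - x i) ∂posGibbsMeasure (fun _ : T3 => (1 : ℝ)) (hsDiameter σ N) (N + 1)) *
        (∫ x, h (x k) * T'.indicator (fun _ => (1 : ℝ)) (x l - x k) ∂posGibbsMeasure (fun _ : T3 => (1 : ℝ)) (hsDiameter σ N) (N + 1))|
        ≤ ζ * (volume T).toReal * (volume T').toReal) :
    |cov[fun x => h (x i) * φ (x j - x i), fun x => h (x k) * φ (x l - x k);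
        posGibbsMeasure (fun _ : T3 => (1 : ℝ)) (hsDiameter σ N) (N + 1)]| ≤
      4 * (ζ * B * B * (volume D).toReal * (volume D).toReal) := by
  haveI := isProbabilityMeasure_posGibbsMeasure continuous_const (fun _ => one_pos) hsd.σ_lt_half.le N
  exact abs_covariance_le_of_indicator_of_abs_le_window (ν := (volume : Measure T3))
    (U := fun x : Fin (N + 1) → T3 => x j - x i) (U' := fun x : Fin (N + 1) → T3 => x l - x k)
    (H := fun x : Fin (N + 1) → T3 => h (x i)) (H' := fun x : Fin (N + 1) → T3 => h (x k))
    ((measurable_pi_apply j).sub (measurable_pi_apply i)) ((measurable_pi_apply l).sub (measurable_pi_apply k))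
    (hh.comp (measurable_pi_apply i)) (hh.comp (measurable_pi_apply k)) (fun x => hh1 _) (fun x => hh1 _) hζ
    (fun T T' hT hT' hTD hT'D => by simpa only [measureReal_def] using hdec T T' hT hT' hTD hT'D) hφ hφ hB hB hφB hφB hφD hφD

/-- **Master covariance bound, windowed** (as `abs_covariance_decorated_le`). [folklore] -/
theorem abs_covariance_decorated_le_window (hsd : SmallDensity uniformProfile σ) (hN : 1 ≤ N) {h φ : T3 → ℝ}
    (hh : Measurable h) (hh1 : ∀ y, |h y| ≤ 1) (hφ : Measurable φ) {B : ℝ} (hB : 0 < B)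
    (hφB : ∀ d, |φ d| ≤ B) {D : Set T3} (hD : MeasurableSet D) (hDs : ∀ d, d ∈ D ↔ -d ∈ D)
    (hφD : ∀ d, φ d ≠ 0 → d ∈ D) {ζ : ℝ} (hζ : 0 ≤ ζ)
    (hdec : ∀ i j k l : Fin (N + 1), i ≠ j → i ≠ k → i ≠ l → j ≠ k → j ≠ l → k ≠ l →
      ∀ T T' : Set T3, MeasurableSet T → MeasurableSet T' → T ⊆ D → T' ⊆ D →
      |(∫ x, h (x i) * T.indicator (fun _ => (1 : ℝ)) (x j - x i) * (h (x k) * T'.indicator (fun _ => (1 : ℝ)) (x l - x k))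
          ∂posGibbsMeasure (fun _ : T3 => (1 : ℝ)) (hsDiameter σ N) (N + 1)) -
        (∫ x, h (x i) * T.indicator (fun _ => (1 : ℝ)) (x j - x i) ∂posGibbsMeasure (fun _ : T3 => (1 : ℝ)) (hsDiameter σ N) (N + 1)) *
        (∫ x, h (x k) * T'.indicator (fun _ => (1 : ℝ)) (x l - x k) ∂posGibbsMeasure (fun _ : T3 => (1 : ℝ)) (hsDiameter σ N) (N + 1))|
        ≤ ζ * (volume T).toReal * (volume T').toReal)
    (i j k l : Fin (N + 1)) (hij : i ≠ j) (hkl : k ≠ l) :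
    |cov[fun x => h (x i) * φ (x j - x i), fun x => h (x k) * φ (x l - x k);
        posGibbsMeasure (fun _ : T3 => (1 : ℝ)) (hsDiameter σ N) (N + 1)]| ≤
      8 * B ^ 2 * (volume D).toReal *
          ((if k = i ∧ l = j then (1 : ℝ) else 0) + (if k = j ∧ l = i then (1 : ℝ) else 0)) +
        24 * B ^ 2 * (volume D).toReal ^ 2 *
          ((if k = i then (1 : ℝ) else 0) + (if k = j then (1 : ℝ) else 0) +
            (if l = i then (1 : ℝ) else 0) + (if l = j then (1 : ℝ) else 0)) +
        4 * (ζ * B * B * (volume D).toReal * (volume D).toReal) := by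
  set v : ℝ := (volume D).toReal with hv
  have hv0 : 0 ≤ v := ENNReal.toReal_nonneg
  have hbA : 0 ≤ 8 * B ^ 2 * v := by positivity
  have hbB : 0 ≤ 24 * B ^ 2 * v ^ 2 := by positivity
  have hbC : 0 ≤ 4 * (ζ * B * B * v * v) := by positivity
  have h01 : ∀ (c : Prop) [Decidable c], (0 : ℝ) ≤ (if c then (1 : ℝ) else 0) := fun c _ => by
    split_ifs <;> norm_num
  -- the six overlap indicators
  set t1 : ℝ := if k = i ∧ l = j then (1 : ℝ) else 0 with ht1
  set t2 : ℝ := if k = j ∧ l = i then (1 : ℝ) else 0 with ht2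
  set t3 : ℝ := if k = i then (1 : ℝ) else 0 with ht3
  set t4 : ℝ := if k = j then (1 : ℝ) else 0 with ht4
  set t5 : ℝ := if l = i then (1 : ℝ) else 0 with ht5
  set t6 : ℝ := if l = j then (1 : ℝ) else 0 with ht6
  have n1 : 0 ≤ 8 * B ^ 2 * v * t1 := mul_nonneg hbA (h01 _)
  have n2 : 0 ≤ 8 * B ^ 2 * v * t2 := mul_nonneg hbA (h01 _)
  have n3 : 0 ≤ 24 * B ^ 2 * v ^ 2 * t3 := mul_nonneg hbB (h01 _)
  have n4 : 0 ≤ 24 * B ^ 2 * v ^ 2 * t4 := mul_nonneg hbB (h01 _)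
  have n5 : 0 ≤ 24 * B ^ 2 * v ^ 2 * t5 := mul_nonneg hbB (h01 _)
  have n6 : 0 ≤ 24 * B ^ 2 * v ^ 2 * t6 := mul_nonneg hbB (h01 _)
  -- the measurable decorated variables and their support bounds
  have hm := fun a b : Fin (N + 1) => measurable_decorated (N := N) hh hφ a b
  have hE := fun a b : Fin (N + 1) => abs_decorated_le_indicator (N := N) hh1 hφB hφD a b
  have hE' := fun a b : Fin (N + 1) => abs_decorated_le_indicator' (N := N) hh1 hφB hDs hφD a b
  have hbd := fun a b : Fin (N + 1) => abs_decorated_le (N := N) hh1 hφB a b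
  by_cases hki : k = i
  · by_cases hlj : l = j
    · -- both labels shared, same orientation
      have e : 8 * B ^ 2 * v * t1 = 8 * B ^ 2 * v := by rw [show t1 = 1 from if_pos ⟨hki, hlj⟩, mul_one]
      have hc : |cov[fun x => h (x i) * φ (x j - x i), fun x => h (x k) * φ (x l - x k);
          posGibbsMeasure (fun _ : T3 => (1 : ℝ)) (hsDiameter σ N) (N + 1)]| ≤ 8 * B ^ 2 * v :=
        abs_covariance_le_of_pairEvent hsd hN (hm i j) (hm k l) hB.le hD (s := i) (a := j) hij (hE i j) (hbd k l)
      linarith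
    · -- shared label `i = k`, partners `j ≠ l`
      have e : 24 * B ^ 2 * v ^ 2 * t3 = 24 * B ^ 2 * v ^ 2 := by rw [show t3 = 1 from if_pos hki, mul_one]
      have hc : |cov[fun x => h (x i) * φ (x j - x i), fun x => h (x k) * φ (x l - x k);
          posGibbsMeasure (fun _ : T3 => (1 : ℝ)) (hsDiameter σ N) (N + 1)]| ≤ 24 * B ^ 2 * v ^ 2 :=
        abs_covariance_le_of_tripleEvent hsd hN (hm i j) (hm k l) hB.le hD (s := i) (a := j) (b := l) hij
          (fun h' => hkl (hki.trans h')) (Ne.symm hlj) (hE i j) (fun x => by simpa only [hki] using hE k l x)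
      linarith
  · by_cases hkj : k = j
    · by_cases hli : l = i
      · -- both labels shared, opposite orientation
        have e : 8 * B ^ 2 * v * t2 = 8 * B ^ 2 * v := by rw [show t2 = 1 from if_pos ⟨hkj, hli⟩, mul_one]
        have hc : |cov[fun x => h (x i) * φ (x j - x i), fun x => h (x k) * φ (x l - x k);
            posGibbsMeasure (fun _ : T3 => (1 : ℝ)) (hsDiameter σ N) (N + 1)]| ≤ 8 * B ^ 2 * v :=
          abs_covariance_le_of_pairEvent hsd hN (hm i j) (hm k l) hB.le hD (s := i) (a := j) hij (hE i j) (hbd k l)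
        linarith
      · -- shared label `j = k`, partners `i ≠ l`
        have e : 24 * B ^ 2 * v ^ 2 * t4 = 24 * B ^ 2 * v ^ 2 := by rw [show t4 = 1 from if_pos hkj, mul_one]
        have hc : |cov[fun x => h (x i) * φ (x j - x i), fun x => h (x k) * φ (x l - x k);
            posGibbsMeasure (fun _ : T3 => (1 : ℝ)) (hsDiameter σ N) (N + 1)]| ≤ 24 * B ^ 2 * v ^ 2 :=
          abs_covariance_le_of_tripleEvent hsd hN (hm i j) (hm k l) hB.le hD (s := j) (a := i) (b := l) hij.symm
            (fun h' => hkl (hkj.trans h')) (Ne.symm hli) (hE' i j) (fun x => by simpa only [hkj] using hE k l x)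
        linarith
    · by_cases hli : l = i
      · -- shared label `i = l`, partners `j ≠ k`
        have e : 24 * B ^ 2 * v ^ 2 * t5 = 24 * B ^ 2 * v ^ 2 := by rw [show t5 = 1 from if_pos hli, mul_one]
        have hc : |cov[fun x => h (x i) * φ (x j - x i), fun x => h (x k) * φ (x l - x k);
            posGibbsMeasure (fun _ : T3 => (1 : ℝ)) (hsDiameter σ N) (N + 1)]| ≤ 24 * B ^ 2 * v ^ 2 :=
          abs_covariance_le_of_tripleEvent hsd hN (hm i j) (hm k l) hB.le hD (s := i) (a := j) (b := k) hij
            (Ne.symm hki) (Ne.symm hkj) (hE i j) (fun x => by simpa only [hli] using hE' k l x)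
        linarith
      · by_cases hlj : l = j
        · -- shared label `j = l`, partners `i ≠ k`
          have e : 24 * B ^ 2 * v ^ 2 * t6 = 24 * B ^ 2 * v ^ 2 := by rw [show t6 = 1 from if_pos hlj, mul_one]
          have hc : |cov[fun x => h (x i) * φ (x j - x i), fun x => h (x k) * φ (x l - x k);
              posGibbsMeasure (fun _ : T3 => (1 : ℝ)) (hsDiameter σ N) (N + 1)]| ≤ 24 * B ^ 2 * v ^ 2 :=
            abs_covariance_le_of_tripleEvent hsd hN (hm i j) (hm k l) hB.le hD (s := j) (a := i) (b := k) hij.symm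
              (Ne.symm hkj) (Ne.symm hki) (hE' i j) (fun x => by simpa only [hlj] using hE' k l x)
          linarith
        · -- four distinct labels
          have hc := abs_covariance_decorated_le_of_dec_window hsd hh hh1 hφ hB hφB hφD hζ
            (hdec i j k l hij (Ne.symm hki) (Ne.symm hli) (Ne.symm hkj) (Ne.symm hlj) hkl)
          linarith

/-- **Variance of the decorated pair sum, windowed plateau** (as `variance_decoratedPairSum_le`). [folklore] -/
theorem variance_decoratedPairSum_le_window (hsd : SmallDensity uniformProfile σ) (hN : 1 ≤ N) {h φ : T3 → ℝ}
    (hh : Measurable h) (hh1 : ∀ y, |h y| ≤ 1) (hφ : Measurable φ) {B : ℝ} (hB : 0 < B)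
    (hφB : ∀ d, |φ d| ≤ B) {D : Set T3} (hD : MeasurableSet D) (hDs : ∀ d, d ∈ D ↔ -d ∈ D)
    (hφD : ∀ d, φ d ≠ 0 → d ∈ D) {ζ : ℝ} (hζ : 0 ≤ ζ)
    (hdec : ∀ i j k l : Fin (N + 1), i ≠ j → i ≠ k → i ≠ l → j ≠ k → j ≠ l → k ≠ l →
      ∀ T T' : Set T3, MeasurableSet T → MeasurableSet T' → T ⊆ D → T' ⊆ D →
      |(∫ x, h (x i) * T.indicator (fun _ => (1 : ℝ)) (x j - x i) * (h (x k) * T'.indicator (fun _ => (1 : ℝ)) (x l - x k))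
          ∂posGibbsMeasure (fun _ : T3 => (1 : ℝ)) (hsDiameter σ N) (N + 1)) -
        (∫ x, h (x i) * T.indicator (fun _ => (1 : ℝ)) (x j - x i) ∂posGibbsMeasure (fun _ : T3 => (1 : ℝ)) (hsDiameter σ N) (N + 1)) *
        (∫ x, h (x k) * T'.indicator (fun _ => (1 : ℝ)) (x l - x k) ∂posGibbsMeasure (fun _ : T3 => (1 : ℝ)) (hsDiameter σ N) (N + 1))|
        ≤ ζ * (volume T).toReal * (volume T').toReal) :
    variance (fun x => ∑ i : Fin (N + 1), ∑ j : Fin (N + 1), if i ≠ j then h (x i) * φ (x j - x i) else 0)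
        (posGibbsMeasure (fun _ : T3 => (1 : ℝ)) (hsDiameter σ N) (N + 1)) ≤
      ((N + 1 : ℕ) : ℝ) ^ 2 * (16 * B ^ 2 * (volume D).toReal +
        96 * ((N + 1 : ℕ) : ℝ) * B ^ 2 * (volume D).toReal ^ 2 +
        4 * ζ * ((N + 1 : ℕ) : ℝ) ^ 2 * B ^ 2 * (volume D).toReal ^ 2) := by
  haveI := isProbabilityMeasure_posGibbsMeasure continuous_const (fun _ => one_pos) hsd.σ_lt_half.le N
  set P := posGibbsMeasure (fun _ : T3 => (1 : ℝ)) (hsDiameter σ N) (N + 1) with hP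
  set v : ℝ := (volume D).toReal with hv
  -- the pair-indexed family
  set Xt : Fin (N + 1) × Fin (N + 1) → (Fin (N + 1) → T3) → ℝ :=
    fun p x => if p.1 ≠ p.2 then h (x p.1) * φ (x p.2 - x p.1) else 0 with hXt
  have hXt_of_ne : ∀ p : Fin (N + 1) × Fin (N + 1), p.1 ≠ p.2 →
      Xt p = fun x => h (x p.1) * φ (x p.2 - x p.1) := fun p hp => by
    funext x; simp only [hXt, if_pos hp]
  have hXt_of_eq : ∀ p : Fin (N + 1) × Fin (N + 1), ¬ p.1 ≠ p.2 → Xt p = 0 := fun p hp => by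
    funext x; simp only [hXt, if_neg hp, Pi.zero_apply]
  have hXt2 : ∀ p, MemLp (Xt p) 2 P := fun p => by
    by_cases hp : p.1 ≠ p.2
    · rw [hXt_of_ne p hp]
      exact memLp_two_of_abs_le' (measurable_decorated hh hφ p.1 p.2) (abs_decorated_le hh1 hφB p.1 p.2)
    · rw [hXt_of_eq p hp]; exact memLp_const 0
  have hfun : (fun x => ∑ i : Fin (N + 1), ∑ j : Fin (N + 1), if i ≠ j then h (x i) * φ (x j - x i) else 0) =
      fun x => ∑ p : Fin (N + 1) × Fin (N + 1), Xt p x := by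
    funext x; rw [Fintype.sum_prod_type]
  -- the bound per pair of pairs
  set bnd : Fin (N + 1) → Fin (N + 1) → Fin (N + 1) → Fin (N + 1) → ℝ := fun i j k l =>
    8 * B ^ 2 * v * ((if k = i ∧ l = j then (1 : ℝ) else 0) + (if k = j ∧ l = i then (1 : ℝ) else 0)) +
      24 * B ^ 2 * v ^ 2 * ((if k = i then (1 : ℝ) else 0) + (if k = j then (1 : ℝ) else 0) +
        (if l = i then (1 : ℝ) else 0) + (if l = j then (1 : ℝ) else 0)) +
      4 * (ζ * B * B * v * v) with hbnd
  have h01 : ∀ (c : Prop) [Decidable c], (0 : ℝ) ≤ (if c then (1 : ℝ) else 0) := fun c _ => by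
    split_ifs <;> norm_num
  have hv0 : 0 ≤ v := ENNReal.toReal_nonneg
  have hbnd0 : ∀ i j k l, 0 ≤ bnd i j k l := fun i j k l => by
    simp only [hbnd]
    have := h01 (k = i ∧ l = j); have := h01 (k = j ∧ l = i); have := h01 (k = i); have := h01 (k = j)
    have := h01 (l = i); have := h01 (l = j)
    positivity
  have hcov : ∀ p q : Fin (N + 1) × Fin (N + 1), cov[Xt p, Xt q; P] ≤ bnd p.1 p.2 q.1 q.2 := by
    intro p q
    by_cases hp : p.1 ≠ p.2
    · by_cases hq : q.1 ≠ q.2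
      · rw [hXt_of_ne p hp, hXt_of_ne q hq]
        exact (le_abs_self _).trans
          (abs_covariance_decorated_le_window hsd hN hh hh1 hφ hB hφB hD hDs hφD hζ hdec p.1 p.2 q.1 q.2 hp hq)
      · rw [hXt_of_eq q hq, covariance_zero_right]; exact hbnd0 _ _ _ _
    · rw [hXt_of_eq p hp, covariance_zero_left]; exact hbnd0 _ _ _ _
  -- the summation of the bounds
  have hsum : ∀ i j : Fin (N + 1), ∑ k : Fin (N + 1), ∑ l : Fin (N + 1), bnd i j k l =
      16 * B ^ 2 * v + 96 * ((N + 1 : ℕ) : ℝ) * B ^ 2 * v ^ 2 + 4 * ζ * ((N + 1 : ℕ) : ℝ) ^ 2 * B ^ 2 * v ^ 2 := by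
    intro i j
    have hA1 := sum_sum_ite_and_eq (N := N) i j
    have hA2 := sum_sum_ite_and_eq (N := N) j i
    obtain ⟨hB1, hB3⟩ := sum_sum_ite_eq (N := N) i
    obtain ⟨hB2, hB4⟩ := sum_sum_ite_eq (N := N) j
    have hC : ∑ _k : Fin (N + 1), ∑ _l : Fin (N + 1), (4 * (ζ * B * B * v * v)) =
        ((N + 1 : ℕ) : ℝ) ^ 2 * (4 * (ζ * B * B * v * v)) := by
      simp only [Finset.sum_const, Finset.card_univ, Fintype.card_fin, nsmul_eq_mul]; ring
    simp only [hbnd, Finset.sum_add_distrib, ← Finset.mul_sum, mul_add]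
    rw [hA1, hA2, hB1, hB2, hB3, hB4]
    simp only [Finset.sum_const, Finset.card_univ, Fintype.card_fin, nsmul_eq_mul]
    push_cast; ring
  rw [hfun, variance_fun_sum hXt2]
  calc ∑ p : Fin (N + 1) × Fin (N + 1), ∑ q : Fin (N + 1) × Fin (N + 1), cov[Xt p, Xt q; P]
      ≤ ∑ p : Fin (N + 1) × Fin (N + 1), ∑ q : Fin (N + 1) × Fin (N + 1), bnd p.1 p.2 q.1 q.2 :=
        Finset.sum_le_sum fun p _ => Finset.sum_le_sum fun q _ => hcov p q
    _ = ∑ i : Fin (N + 1), ∑ j : Fin (N + 1),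
          (16 * B ^ 2 * v + 96 * ((N + 1 : ℕ) : ℝ) * B ^ 2 * v ^ 2 + 4 * ζ * ((N + 1 : ℕ) : ℝ) ^ 2 * B ^ 2 * v ^ 2) := by
        rw [Fintype.sum_prod_type]
        refine Finset.sum_congr rfl fun i _ => Finset.sum_congr rfl fun j _ => ?_
        rw [Fintype.sum_prod_type]
        exact hsum i j
    _ = _ := by
        simp only [Finset.sum_const, Finset.card_univ, Fintype.card_fin, nsmul_eq_mul]; push_cast; ring

end Literature.MathematicalPhysics.KineticTheory

end
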